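import Literature.AnabelianGeometry.EtaleTheta.FrobenioidTheta

/-!
# [EtTh] §5: bi-Kummer theory of the theta function — Prop. 5.1, 5.2 (pp. 323–327 / PDF pp. 97–101)

Mochizuki, *The étale theta function …*, Publ. RIMS **45** (2009) [cite: MochizukiEtTh2009, §5 p.323 (PDF p.97)].
Seat abc-iut-L2-t4.  This file types, over the §5 data `ThetaFrobenioid` of `FrobenioidTheta.lean`:
* the constants `(K^×)^{1/N}`, `(O_K^×)^{1/N}` (Lemma 5.8, p.331 (PDF p.105)) and the isomorphism
  `Aut_D(A_N^bs) ⥲ Aut_D(B_N^bs)` "determined by the base-equivalent pair `s^⊓_N, s^⊔_N`" (p.331 (PDF p.105)),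
  with the DEFINING RELATIONS of `s^⊓-gp_N`, `s^⊔-gp_N` (p.331 (PDF p.105)) and the bi-Kummer difference
  cocycle (Prop. 4.3 (iii)) as named facts;
* **Proposition 5.1** (Applicability of the General Theory) as a conjunction of the §3/§4 predicates
  it lists — these are abc-iut-L2-t3's notions, carried by the vocabulary stub
  `FrobenioidThetaBiKummer.TemperedVocabStub` (`TODO-merge(abc-iut-L2-t3)`);
* **Proposition 5.2** (Bi-Kummer Theory) (i)–(iii), over the §4 vocabulary stub
  `FrobenioidThetaBiKummer.BiKummerVocabStub` (`TODO-merge(abc-iut-L2-t3)`), with the §1 data it is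
  compared to (actions of Prop. 1.1 (ii) / Lem. 1.2, the class `η̲̈^Θ`) entering as PARAMETERS to be
  instantiated by abc-iut-L2-t1/t2's decls;
* (**Proposition 5.3**, the geometry of divisors of `A_⊚`, is typed in `FrobenioidThetaDivisors.lean`.)

Remark 5.1.1 (p.323 (PDF p.97)) — NO decl (commentary): "In Proposition 5.1, as well as in the discussion of
the remainder of the present §5, we restrict our attention to self-equivalences … mainly to simplify
the discussion … the extension to the case of arbitrary equivalences between possibly distinct
categories satisfying similar hypotheses is, for the most part, immediate … one concludes immediately
the existence of 'functorial category-theoretic algorithms', in the style of Corollaries 2.18, 2.19."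
Remark 5.2.1 (p.324 (PDF p.98)) — NO decl (pointer): "The natural isomorphisms of Proposition 5.2, (iii),
constitute a scheme-theoretic ingredient in the otherwise Frobenioid-theoretic formulation of
Proposition 5.2 … The translation of this final scheme-theoretic ingredient into category theory is
the topic of Proposition 5.5; Theorems 5.6, 5.7 below."
HONEST FRAMING: statements are typed as `Prop`-valued predicates, never asserted; typed ≠ proved.

v3 (R-9 repair, referee finding D4-F7 / RQ7 audit abc-iut-L6-t23 20:47:51Z, filed under the L2 succession
rule for abc-iut-L2-t4): the bi-Kummer difference in `ThetaPairKummerClass` is now PRINT's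
`s^⊓-gp_N · (s^⊔-gp_N)⁻¹` (kurims pp.79, 83, 95); `BiKummerDifferenceMem` keeps its (equivalent, inverse)
body for the consumers and gains `biKummerDifferenceMem_iff`; nothing else changed.
-/

namespace Literature.AnabelianGeometry.EtaleTheta

open CategoryTheory

universe w v v' u u'

namespace ThetaFrobenioid

variable {C : Type u} [Category.{v} C] {D : Type u'} [Category.{v'} D] (𝔉 : ThetaFrobenioid.{w} C D)

/-! ### Constants (Lemma 5.8, p. 331) and the base isomorphism `A_N^bs ≅ B_N^bs` -/

/-- `(K^×)^{1/N} ⊆ O^×(B_N^birat)`: "the subgroup of elements whose `N`-th power lies in the image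
of the natural inclusion `K^× ↪ O^×(B_N^birat)`" (Lemma 5.8, p.331 (PDF p.105)).
[cite: MochizukiEtTh2009, Lem 5.8 p.331 (PDF p.105)] -/
def KxRootN : Subgroup (𝔉.biratUnits 𝔉.BN) := (𝔉.constEmb.range).comap (powMonoidHom (𝔉.N : ℕ))

/-- Membership in `(K^×)^{1/N}`. [cite: MochizukiEtTh2009, Lem 5.8 p.331 (PDF p.105)] -/
theorem mem_KxRootN {f : 𝔉.biratUnits 𝔉.BN} :
    f ∈ 𝔉.KxRootN ↔ f ^ (𝔉.N : ℕ) ∈ 𝔉.constEmb.range := Iff.rfl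

/-- `(O_K^×)^{1/N} := (K^×)^{1/N} ∩ O^×(B_N)` (Lemma 5.8, p.331 (PDF p.105)), as a subgroup of
`O^×(B_N) ⊆ Aut_C(B_N)` (the intersection is formed in `O^×(B_N^birat)` along
`O^×(B_N) ↪ O^×(B_N^birat)`).  [cite: MochizukiEtTh2009, Lem 5.8 p.331 (PDF p.105)] -/
def OKxRootN : Subgroup (Aut 𝔉.BN) :=
  (𝔉.KxRootN.comap (𝔉.unitsToBirat 𝔉.BN)).map (𝔉.units 𝔉.BN).subtype

/-- `(O_K^×)^{1/N} ⊆ O^×(B_N)`. [cite: MochizukiEtTh2009, Lem 5.8 p.331 (PDF p.105)] -/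
theorem OKxRootN_le_units : 𝔉.OKxRootN ≤ 𝔉.units 𝔉.BN := by
  rintro _ ⟨u, _, rfl⟩
  exact u.2

/-- `(s^⊓_N)^bs = (s^⊔_N)^bs : A_N^bs ⥲ B_N^bs` as an isomorphism of `D` (pre-steps are
base-isomorphisms).  [cite: MochizukiEtTh2009, §5 p.331 (PDF p.105)] -/
noncomputable def baseIsoAB : 𝔉.base.obj 𝔉.AN ≅ 𝔉.base.obj 𝔉.BN :=
  haveI : IsIso (𝔉.base.map 𝔉.sCap) := 𝔉.isPreStep_sCap.2
  asIso (𝔉.base.map 𝔉.sCap)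

/-- The isomorphism `Aut_D(A_N^bs) ⥲ Aut_D(B_N^bs)` "determined by the [base-equivalent!] pair of
morphisms `s^⊓_N, s^⊔_N`" (p.331 (PDF p.105); Prop. 4.3 (i)): conjugation by `(s^⊓_N)^bs`.
[cite: MochizukiEtTh2009, §5 p.331 (PDF p.105)] -/
noncomputable def autBaseIsoAB : Aut (𝔉.base.obj 𝔉.AN) ≃* Aut (𝔉.base.obj 𝔉.BN) :=
  𝔉.baseIsoAB.conjAut

/-- `H_{A_N} ⊆ Aut_D(A_N^bs)`, corresponding to `H_{B_N}` under `Aut_D(A_N^bs) ⥲ Aut_D(B_N^bs)`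
(p.331 "`H_{A_N} ⥲ H_{B_N}`").  [cite: MochizukiEtTh2009, §5 p.331 (PDF p.105)] -/
noncomputable def HA : Subgroup (Aut (𝔉.base.obj 𝔉.AN)) := 𝔉.HB.comap 𝔉.autBaseIsoAB.toMonoidHom

/-- The defining relation of `s^⊓-gp_N` (p.331 (PDF p.105)): "`s^⊓-gp_N(g) ∘ s^⊓_N = s^⊓_N ∘ (s^trv_N|…)(g)`
for all `g ∈ Aut_D(B_N^bs)`", relative to `Aut_D(A_N^bs) ⥲ Aut_D(B_N^bs)`; in diagrammatic order
`s^⊓_N ≫ s^⊓-gp_N(g) = s^trv_N(g') ≫ s^⊓_N`.  The text asserts that `s^trv_N` (determined up to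
`O^×(A_N)`-conjugation) "determines unique group homomorphisms" with this property
[cf. Props. 4.3 (i); 5.2 (ii)].  [cite: MochizukiEtTh2009, §5 p.331 (PDF p.105)] -/
def SgpCapSpec : Prop :=
  ∀ g : Aut (𝔉.base.obj 𝔉.BN),
    𝔉.sCap ≫ (𝔉.sgpCap g).hom = (𝔉.strv (𝔉.autBaseIsoAB.symm g)).hom ≫ 𝔉.sCap

/-- The defining relation of `s^⊔-gp_N` (p.331 (PDF p.105)): "`s^⊔-gp_N(h) ∘ s^⊔_N = s^⊔_N ∘ (s^trv_N|_{H_{B_N}})(h)`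
for all `h ∈ H_{B_N}`".  [cite: MochizukiEtTh2009, §5 p.331 (PDF p.105)] -/
def SgpCupSpec : Prop :=
  ∀ h : 𝔉.HB,
    𝔉.sCup ≫ (𝔉.sgpCup h).hom = (𝔉.strv (𝔉.autBaseIsoAB.symm (h : Aut (𝔉.base.obj 𝔉.BN)))).hom ≫ 𝔉.sCup

/-- Uniqueness clause of p.331 (PDF p.105) ("determines unique group homomorphisms"): any pair of
homomorphisms satisfying the two defining relations equals `(s^⊓-gp_N, s^⊔-gp_N)`.
[cite: MochizukiEtTh2009, §5 p.331 (PDF p.105)] -/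
def SgpUnique : Prop :=
  ∀ (a : Aut (𝔉.base.obj 𝔉.BN) →* Aut 𝔉.BN) (b : 𝔉.HB →* Aut 𝔉.BN),
    (∀ g, 𝔉.sCap ≫ (a g).hom = (𝔉.strv (𝔉.autBaseIsoAB.symm g)).hom ≫ 𝔉.sCap) →
    (∀ h : 𝔉.HB, 𝔉.sCup ≫ (b h).hom =
      (𝔉.strv (𝔉.autBaseIsoAB.symm (h : Aut (𝔉.base.obj 𝔉.BN)))).hom ≫ 𝔉.sCup) →
    a = 𝔉.sgpCap ∧ b = 𝔉.sgpCup

/-- The uniqueness clause PROVED from the defining relations, given that `s^⊓_N`, `s^⊔_N` are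
epimorphisms (every morphism of a Frobenioid is: "totally epimorphic", [FrdI] Def. 1.3 / §0).
[cite: MochizukiEtTh2009, §5 p.331 (PDF p.105)] -/
theorem sgpUnique_of (hcap : 𝔉.SgpCapSpec) (hcup : 𝔉.SgpCupSpec) [Epi 𝔉.sCap] [Epi 𝔉.sCup] :
    𝔉.SgpUnique := by
  intro a b ha hb
  constructor
  · ext g : 1
    apply Aut.ext
    exact cancel_epi 𝔉.sCap |>.mp ((ha g).trans (hcap g).symm)
  · ext h : 1
    apply Aut.ext
    exact cancel_epi 𝔉.sCup |>.mp ((hb h).trans (hcup h).symm)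

/-- `s^⊓-gp_N` is a section of `Aut_C(B_N) → Aut_D(B_N^bs)`: `(s^⊓-gp_N(g))^bs = g` (apply `(−)^bs`
to the defining relation: `s^trv_N` is a section over `A_N^bs` by [FrdI] Prop. 5.6, and
`(s^⊓_N)^bs` conjugates `Aut_D(A_N^bs)` onto `Aut_D(B_N^bs)`; used in Lemma 5.9 (ii)).
[cite: MochizukiEtTh2009, §5 p.331 (PDF p.105)] -/
def SgpCapSection : Prop := ∀ g : Aut (𝔉.base.obj 𝔉.BN), 𝔉.autBase 𝔉.BN (𝔉.sgpCap g) = g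

/-- `s^trv_N` is a section of `Aut_C(A_N) → Aut_D(A_N^bs)`: it "aris[es] from a base-Frobenius pair of
`A_N`" ([EtTh] Thm. 3.7 (i); [FrdI] Def. 2.7 (iii), Prop. 5.6), i.e. splits the projection over its
domain (pp.330–331 (PDF pp.104–105)).  Named hypothesis (abc-iut-L2-t3 / abc-iut-L1-t2 vocabulary).
[cite: MochizukiEtTh2009, §5 p.331 (PDF p.105)] -/
def StrvSection : Prop := ∀ g : Aut (𝔉.base.obj 𝔉.AN), 𝔉.autBase 𝔉.AN (𝔉.strv g) = g

/-- `SgpCapSection` PROVED from the defining relation `SgpCapSpec` and the section property of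
`s^trv_N`: apply `(−)^bs` to `s^⊓_N ≫ s^⊓-gp_N(g) = s^trv_N(g') ≫ s^⊓_N` and conjugate by `(s^⊓_N)^bs`.
[cite: MochizukiEtTh2009, §5 p.331 (PDF p.105)] -/
theorem sgpCapSection_of (hspec : 𝔉.SgpCapSpec) (hstrv : 𝔉.StrvSection) : 𝔉.SgpCapSection := by
  intro g
  obtain ⟨g', rfl⟩ := 𝔉.autBaseIsoAB.surjective g
  have key := congrArg 𝔉.base.map (hspec (𝔉.autBaseIsoAB g'))
  rw [Functor.map_comp, Functor.map_comp, MulEquiv.symm_apply_apply] at key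
  have hs : 𝔉.base.map (𝔉.strv g').hom = g'.hom := congrArg Iso.hom (hstrv g')
  rw [hs] at key
  apply Aut.ext
  change 𝔉.base.map (𝔉.sgpCap (𝔉.autBaseIsoAB g')).hom = (𝔉.baseIsoAB.conjAut g').hom
  rw [Iso.conjAut_hom, Iso.conj_apply]
  exact (Iso.eq_inv_comp 𝔉.baseIsoAB).mpr key

/-- The bi-Kummer difference cocycle takes values in the cyclotome: "the difference
`s^⊓-gp_N · (s^⊔-gp_N)⁻¹` determines a twisted homomorphism `H_{B_N} → μ_N(B_N)`" (Prop. 4.3 (iii),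
p.317 (PDF p.91) — kurims p.83 prints the difference as `s^⊓-gp_N · (s^⊔-gp_N)^{-1}`, zero-divisor
section FIRST — for the bi-Kummer `N`-th root `(s^⊓-gp_N, s^⊔-gp_N)` of p.331 (PDF p.105)).  The
membership is typed for the INVERSE difference `s^⊔-gp_N(h) · s^⊓-gp_N(h)⁻¹`, which is equivalent
(`μ_N(B_N)` is a subgroup; see `biKummerDifferenceMem_iff` below) and is the form the consumers
(`FrobenioidMonoTheta.lean`) use.  [cite: MochizukiEtTh2009, §5 p.331 (PDF p.105)] -/
def BiKummerDifferenceMem : Prop :=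
  ∀ h : 𝔉.HB, 𝔉.sgpCup h * (𝔉.sgpCap (h : Aut (𝔉.base.obj 𝔉.BN)))⁻¹ ∈ 𝔉.muTorsion 𝔉.BN 𝔉.N

/-- `BiKummerDifferenceMem` in PRINT's orientation: `s^⊓-gp_N(h) · s^⊔-gp_N(h)⁻¹ ∈ μ_N(B_N)` for all
`h ∈ H_{B_N}` (Prop. 4.3 (iii), kurims p.83) — equivalent to the typed (inverse) form.
[cite: MochizukiEtTh2009, Prop 4.3 (iii) p.317 (PDF p.91)] -/
theorem biKummerDifferenceMem_iff :
    𝔉.BiKummerDifferenceMem ↔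
      ∀ h : 𝔉.HB, 𝔉.sgpCap (h : Aut (𝔉.base.obj 𝔉.BN)) * (𝔉.sgpCup h)⁻¹ ∈ 𝔉.muTorsion 𝔉.BN 𝔉.N := by
  refine forall_congr' fun h => ?_
  rw [← inv_mem_iff (x := 𝔉.sgpCup h * _), mul_inv_rev, inv_inv]

end ThetaFrobenioid

namespace FrobenioidThetaBiKummer

variable {C : Type u} [Category.{v} C] {D : Type u'} [Category.{v'} D]

/-- **LOCAL STUB — `TODO-merge(abc-iut-L2-t3)`.**  The §3/§4 predicates that Proposition 5.1 lists,
as opaque `Prop`s attached to the data `𝔉` (owner decls: abc-iut-L2-t3's Def. 3.6 "tempered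
Frobenioid", Thm. 3.7 / Cor. 3.8 "rationally standard type", [FrdI] §0 "slim", [FrdI] Def. 1.1
"perfect", "perf-factorial", "non-dilating", [EtTh] Def. 3.? "cuspidally pure", and the hypothesis
packages of Cor. 3.8 (i)(ii)(iii) and Thm. 4.4).  Each field is to be instantiated by the owner's
predicate applied to the real `C`; nothing here constrains them.
[cite: MochizukiEtTh2009, Prop 5.1 p.323 (PDF p.97)] -/
structure TemperedVocabStub (𝔉 : ThetaFrobenioid.{w} C D) where
  /-- "`C` is a tempered Frobenioid" (Def. 3.6 (ii)). -/
  IsTemperedFrobenioid : Prop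
  /-- "of rationally standard type" (Thm. 3.7 / Def. 3.6). -/
  IsRationallyStandard : Prop
  /-- "over a slim base category `D`" ([FrdI] §0). -/
  IsSlimBase : Prop
  /-- "whose monoid type is `ℤ`" (Def. 3.6). -/
  IsMonoidTypeZ : Prop
  /-- "whose divisor monoid `Φ(−)` is perfect" ([FrdI] Def. 1.1 (i),(ii)). -/
  IsPerfect : Prop
  /-- "perf-factorial" ([FrdI] Def. 2.4 (i)). -/
  IsPerfFactorial : Prop
  /-- "non-dilating" ([FrdI] Def. 1.1 (i),(ii)). -/
  IsNonDilating : Prop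
  /-- "cuspidally pure" ([EtTh] §3). -/
  IsCuspidallyPure : Prop
  /-- "all of the hypotheses of Corollary 3.8, (i), (ii), (iii)" for `C` and a self-equivalence `Ψ`. -/
  HypothesesCor38 : (C ≌ C) → Prop
  /-- "all of the hypotheses of … Theorem 4.4 [for `C₁`, `C₂`, `Ψ : C₁ ⥲ C₂`]". -/
  HypothesesThm44 : (C ≌ C) → Prop

/-- **[EtTh] Proposition 5.1 (Applicability of the General Theory)** (p.323 (PDF p.97)), for the §5 Frobenioid
`C` and a self-equivalence `Ψ : C ⥲ C`: "The Frobenioid `C` is a tempered Frobenioid of rationally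
standard type over a slim base category `D`, whose monoid type is `ℤ`, and whose divisor monoid `Φ(−)`
is perfect, perf-factorial, non-dilating, and cuspidally pure. In particular, `C` and the
self-equivalence `Ψ : C ⥲ C` satisfy all of the hypotheses of Corollary 3.8, (i), (ii), (iii);
Theorem 4.4 [for '`C₁`', '`C₂`', '`Ψ : C₁ ⥲ C₂`']."  (The text: "it follows from Example 3.9, (iv),
that we have the following"; no sub-items.)  Typed as the conjunction of the stub predicates.
[cite: MochizukiEtTh2009, Prop 5.1 p.323 (PDF p.97)] -/
structure ApplicabilityOfGeneralTheory (𝔉 : ThetaFrobenioid.{w} C D) (V : TemperedVocabStub 𝔉)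
    (Ψ : C ≌ C) : Prop where
  /-- "a tempered Frobenioid" -/
  tempered : V.IsTemperedFrobenioid
  /-- "of rationally standard type" -/
  rationallyStandard : V.IsRationallyStandard
  /-- "over a slim base category `D`" -/
  slimBase : V.IsSlimBase
  /-- "whose monoid type is `ℤ`" -/
  monoidTypeZ : V.IsMonoidTypeZ
  /-- "whose divisor monoid `Φ(−)` is perfect" -/
  perfect : V.IsPerfect
  /-- "perf-factorial" -/
  perfFactorial : V.IsPerfFactorial
  /-- "non-dilating" -/
  nonDilating : V.IsNonDilating
  /-- "and cuspidally pure" -/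
  cuspidallyPure : V.IsCuspidallyPure
  /-- "`C` and … `Ψ` satisfy all of the hypotheses of Corollary 3.8, (i), (ii), (iii)" -/
  hypothesesCor38 : V.HypothesesCor38 Ψ
  /-- "… Theorem 4.4" -/
  hypothesesThm44 : V.HypothesesThm44 Ψ

/-- **LOCAL STUB — `TODO-merge(abc-iut-L2-t3)`.**  The §4 relations that Proposition 5.2 (i) uses:
"`(s, s')` is an `M`-th root of a right fraction-pair [cf. Proposition 4.2, (iii)] of `f`" for
`f ∈ O^×(A^birat)` and a pair of morphisms `s, s' : S → T` (Def. 4.1 (i), Prop. 4.2 (iii)), and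
"`g` is an `l`-th root of `f`" for log-meromorphic functions on possibly different objects
(Rmk. 4.3.2).  [cite: MochizukiEtTh2009, Prop 5.2 p.324 (PDF p.98)] -/
structure BiKummerVocabStub (𝔉 : ThetaFrobenioid.{w} C D) where
  /-- `(s, s')` "constitutes an `M`-th root of a right fraction-pair [cf. Proposition 4.2, (iii)]"
  of `f ∈ O^×(A^birat)` (with `N`-domain `S`, `N`-codomain `T`). -/
  IsRootOfRightFractionPair : ℕ → ∀ {A S T : C}, 𝔉.biratUnits A → (S ⟶ T) → (S ⟶ T) → Prop
  /-- "`g` is an `l`-th root of `f`" as log-meromorphic functions ([EtTh] Def. 3.1 (ii); Rmk. 4.3.2),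
  `g ∈ O^×(A'^birat)`, `f ∈ O^×(A^birat)`. -/
  IsRootOf : ℕ → ∀ {A' A : C}, 𝔉.biratUnits A' → 𝔉.biratUnits A → Prop

variable (𝔉 : ThetaFrobenioid.{w} C D)

/-- **[EtTh] Proposition 5.2 (i)** (p.324 (PDF p.98)): "The pair of morphisms of `C` determined by '`s_{l·N}`',
'`τ_{l·N}`' [our `s^⊓_N, s^⊔_N : A_N → B_N`] constitutes an `l·N`-th root of a right fraction-pair
[cf. Proposition 4.2, (iii)] of [the Frobenioid-theoretic version of the log-meromorphic function
constituted by] the theta function `Θ̈` of Proposition 1.4, or, alternatively, an `N`-th root of a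
right fraction-pair of [… ] an `l`-th root of the theta function `Θ̈` [cf. Remark 4.3.2]."
[cite: MochizukiEtTh2009, Prop 5.2 (i) p.324 (PDF p.98)] -/
def ThetaPairIsRoot (V : BiKummerVocabStub 𝔉) : Prop :=
  V.IsRootOfRightFractionPair (𝔉.l * 𝔉.N) 𝔉.thetaFn 𝔉.sCap 𝔉.sCup ∧
    ∃ (A' : C) (g : 𝔉.biratUnits A'), V.IsRootOf 𝔉.l g 𝔉.thetaFn ∧
      V.IsRootOfRightFractionPair 𝔉.N g 𝔉.sCap 𝔉.sCup

/-- **[EtTh] Proposition 5.2 (ii)** (p.324 (PDF p.98)): "The group actions of Proposition 1.1, (ii); Lemma 1.2,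
arising from '`s_{l·N}`', '`τ_{l·N}`', respectively, are precisely the actions determined by the
bi-Kummer `l·N`-th root [cf. Proposition 4.3, (i)] arising from the `l·N`-th root of (i)."  Typed as
a predicate on the two §1 actions, rendered as homomorphisms `H_{B_N} → Aut_C(B_N)` (PARAMETERS
`actS`, `actT`: to be instantiated by abc-iut-L2-t1's Prop. 1.1 (ii) / Lem. 1.2 data transported to
`B_N`, `TODO-merge(abc-iut-L2-t1)`): they coincide with `s^⊓-gp_N|_{H_{B_N}}`, `s^⊔-gp_N`.
[cite: MochizukiEtTh2009, Prop 5.2 (ii) p.324 (PDF p.98)] -/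
def ThetaPairActionsAgree (actS actT : 𝔉.HB →* Aut 𝔉.BN) : Prop :=
  actS = 𝔉.sgpCap.comp 𝔉.HB.subtype ∧ actT = 𝔉.sgpCup

/-- **[EtTh] Proposition 5.2 (iii)** (p.324 (PDF p.98)), the `N`-version used in the rest of §5: "the Kummer
class determined by the bi-Kummer `N`-th root of (i) [cf. Proposition 4.3, (iii)]
corresponds precisely to the reduction modulo `N` of the class '`η̲̈^Θ`' of the discussion preceding
Definition 2.7 — i.e., to an `l`-th root of the 'étale theta function' — relative to the natural
isomorphism between '`μ_N(−) = l·μ_{l·N}(−)`' and `(l·Δ_Θ) ⊗ (ℤ/Nℤ)`" (wording as corrected by the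
author, Comments on [EtTh] (Mar 2022) (xi): the 2009 printing has "bi-Kummer `N`-th root of the `N`-th root
of (i)").  (The `l·N`-version with
`η̈^Θ` of Prop. 1.3 and `Δ_Θ ⊗ ℤ/l·Nℤ` is the same statement with `l·N` for `N`.)  Typed at the
level of cocycles on `H_{B_N}`: PARAMETERS `η` — a cocycle representing the reduction mod `N` of
`η̲̈^Θ` pulled back to `H_{B_N}` with values in `(l·Δ_Θ)_{B_N} ⊗ ℤ/Nℤ` (`TODO-merge(abc-iut-L2-t2)`)
— and `ν`, "the natural isomorphism" (Rmk. 5.2.1; Prop. 5.5); the CLASS-level statement lives in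
abc-iut-L2-t1's continuous `ContH1` (L2-lead ruling 18:25Z, `TODO-merge(abc-iut-L2-t1)`); statement: the bi-Kummer difference
cocycle `h ↦ s^⊓-gp_N(h) · s^⊔-gp_N(h)⁻¹` — PRINT's orientation, zero-divisor section first: Def. 4.1 (i)
kurims p.79 "`s^⊓ · (s^⊔)^{-1} = f`", Prop. 4.3 (iii) kurims p.83 "the difference `s^⊓-gp_N · (s^⊔-gp_N)^{-1}`
… is equal to the Kummer class `κ_{f|B_N}`" (v3, R-9 repair of referee finding D4-F7: v2 had the
inverse difference, i.e. `κ^{-1}`) — equals `ν ∘ η` up to a `μ_N(B_N)`-valued coboundary.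
[cite: MochizukiEtTh2009, Prop 5.2 (iii) p.324 (PDF p.98); Comments (Mar 2022) (xi)] -/
def ThetaPairKummerClass (η : 𝔉.HB → 𝔉.lDeltaModN 𝔉.BN)
    (ν : 𝔉.lDeltaModN 𝔉.BN ≃* 𝔉.muTorsion 𝔉.BN 𝔉.N) : Prop :=
  ∃ u ∈ 𝔉.muTorsion 𝔉.BN 𝔉.N, ∀ h : 𝔉.HB,
    𝔉.sgpCap (h : Aut (𝔉.base.obj 𝔉.BN)) * (𝔉.sgpCup h)⁻¹ =
      (𝔉.sgpCap (h : Aut (𝔉.base.obj 𝔉.BN)) * u * (𝔉.sgpCap (h : Aut (𝔉.base.obj 𝔉.BN)))⁻¹ * u⁻¹) *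
        (ν (η h) : Aut 𝔉.BN)

end FrobenioidThetaBiKummer

end Literature.AnabelianGeometry.EtaleTheta
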